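import Literature.Probability.Percolation.SlabRSWSnapLocal
import Literature.Probability.Percolation.SlabRSWSnapChains
import HarnessLib

/-!
# Newman–Tassion–Wu 2017, Lemma 3.16 — the local modification in each layout of the frame

Topic: `Literature/Probability/Percolation`. `SlabRSWSnapLocal.gadget_of_local` produces the local
modification of the coarse-grained gluing datum from a free routing region `K` and port data; this
file supplies those for each of the five layouts of `SlabRSWSnapLayout.lean` (`clear`: `K` = the box;
`halfV`/`halfH`: the open half-box, port = the line; `quad`: the open quadrant, port = the column
half-line; `ell`: the L-shaped cross, port = the quadrant's inner column side) — the routers are the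
tree's `exists_route` (DST's box) and `exists_route_cross`; the two target pairs of the `SurgeryB` case
are read off the traces of the tiles of `N` and `τN` through the given target cell.

* `LocalCtx` — the common data (configuration of `𝒳`, frame, anchor, contact);
* `gadget_clear`, `gadget_halfV`, `gadget_halfH`, `gadget_quad`, `gadget_ell`; `gadget_of_layout`.

## Sources

* C. M. Newman, V. Tassion, W. Wu, *Critical percolation and the minimal spanning tree in slabs*,
  Comm. Pure Appl. Math. 70 (2017), arXiv:1512.09107: §3.2, proof of Theorem 3.7; §3.5, proof of
  Lemma 3.16 ("the domain `K_□` is regular enough to apply Theorem 3.6") [NewmanTassionWu2017].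
-/

noncomputable section

namespace Literature.Probability.Percolation

open MeasureTheory LatticeModels SimpleGraph

namespace NTW17

variable {k : ℕ}

/-! ## The common data -/

/-- **The data common to all layouts**: `k ≥ 1`; `Γ ⊆ [0,7n] × [0,·)`; a lattice configuration
`ω ∈ 𝒳` of `Q₂ = snapGlue n hn Γ`; a frame of `p ∉ M` whose box meets neither `A` nor `C`; the anchor
`g⋆ ∈ Γ₁` over `p` (not the last vertex of `Γ₁`) with a `Γ₁`-neighbour `u`; the vertex `g₀` of
`Γ₁` near the contact (`g⋆`, or the last vertex if adjacent to `g⋆`); the normalised contact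
`c₀, l ++ [q]` with `planar q` within `1` of `planar g₀`.
[cite: NewmanTassionWu2017, §3.2 (proof of Theorem 3.7, step (1)); §3.5 (proof of Lemma 3.16)] -/
structure LocalCtx (k n : ℕ) (hn : 1 ≤ n) (Γ : List (slab 3 k)) (ω : BondConfig (slab 3 k))
    (p : ℤ × ℤ) (x₁ x₂ y₁ y₂ X Y : ℤ) (gs u g₀ c₀ q : slab 3 k) (l : List (slab 3 k)) : Prop where
  hk : 1 ≤ k
  hΓ : ∀ g ∈ Γ, 0 ≤ (planar k g).1 ∧ (planar k g).1 ≤ 7 * n ∧ 0 ≤ (planar k g).2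
  hω : ω ⊆ (slabGraph 3 k).edgeSet
  hX : ω ∈ (snapGlue k n hn Γ).evX k
  hF : IsFrame n p x₁ x₂ y₁ y₂ X Y
  hW : IsFrameND n x₁ x₂ y₁ X Y
  hpM : p ∉ snapNbhd k n Γ ∪ snapNbhdR k n Γ
  hBA : ∀ z ∈ boxR x₁ x₂ y₁ y₂, z ∉ (snapGlue k n hn Γ).A
  hBC : ∀ z ∈ boxR x₁ x₂ y₁ y₂, z ∉ (snapGlue k n hn Γ).C
  hgs : gs ∈ (snapGlue k n hn Γ).γ k ω
  hgsp : planar k gs = p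
  hgsl : ∀ hne : (snapGlue k n hn Γ).γ k ω ≠ [], gs ≠ ((snapGlue k n hn Γ).γ k ω).getLast hne
  hu : u ∈ (snapGlue k n hn Γ).γ k ω
  hugs : u ≠ gs
  huadj : (slabGraph 3 k).Adj u gs
  hg₀ : g₀ ∈ (snapGlue k n hn Γ).γ k ω
  hg₀gs : g₀ = gs ∨ ((slabGraph 3 k).Adj g₀ gs ∧
    ∀ hne : (snapGlue k n hn Γ).γ k ω ≠ [], g₀ = ((snapGlue k n hn Γ).γ k ω).getLast hne)
  hc₀ : c₀ ∈ slabLift k (snapGlue k n hn Γ).C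
  hch : (l ++ [q]).IsChain (fun a b => s(a, b) ∈ ω ∧ a ≠ b)
  hnd : (l ++ [q]).Nodup
  hsub : ∀ x ∈ l ++ [q], x ∈ slabLift k (snapGlue k n hn Γ).R
  hhead : (l ++ [q]).head (by simp) = c₀
  hfar : ∀ x ∈ l, ¬Near k ((snapGlue k n hn Γ).γ k ω) 1 (planar k x)
  hl : l ≠ []
  hqg₀ : planar k q ∈ sqBox (planar k g₀) 1


/-! ## Separation facts and second target pairs in the `quad` layout -/

section QuadPairs

variable {n : ℕ} {Γ : List (slab 3 k)} {p : ℤ × ℤ} {x₁ x₂ y₁ y₂ X Y : ℤ} {C : Set (ℤ × ℤ)}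

/-- A tile cell `(X, y)` on the column of a non-tile cell `t = (X, t.2)` is separated from it by the
line `Y`. [cite: NewmanTassionWu2017, §3.5 (proof of Lemma 3.16)] -/
theorem sep_col (hF : IsFrame n p x₁ x₂ y₁ y₂ X Y) (hW : IsFrameND n x₁ x₂ y₁ X Y)
    (hC : ∀ c ∈ C, LatCentre n c) {t : ℤ × ℤ} (htB : t ∈ boxR x₁ x₂ y₁ y₂) (htN : t ∉ tileUnion C)
    (ht1 : t.1 = X) {y : ℤ} (hy : y₁ ≤ y ∧ y ≤ y₂) (hN : (X, y) ∈ tileUnion C) :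
    (t.2 < Y ∧ Y ≤ y) ∨ (y ≤ Y ∧ Y < t.2) := by
  have htB' := htB
  rw [mem_boxR_iff] at htB'
  have hzB : (X, y) ∈ boxR x₁ x₂ y₁ y₂ := by rw [mem_boxR_iff]; simp only; omega
  obtain ⟨lo, hi, lo', hi', hxT, hyT, hcov, hwin⟩ := tile_trace_int hF hW hC hN hzB
  simp only at hwin
  have htnot : ¬(lo' ≤ t.2 ∧ t.2 ≤ hi') := fun hh =>
    htN (hcov t (by omega) (by omega) hh.1 hh.2 htB'.1 htB'.2.1 htB'.2.2.1 htB'.2.2.2)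
  rcases hyT with h | h | h <;> omega

/-- A tile cell `(x, Y)` on the row of a non-tile cell `t = (t.1, Y)` is separated from it by the
line `X`. [cite: NewmanTassionWu2017, §3.5 (proof of Lemma 3.16)] -/
theorem sep_row (hF : IsFrame n p x₁ x₂ y₁ y₂ X Y) (hW : IsFrameND n x₁ x₂ y₁ X Y)
    (hC : ∀ c ∈ C, LatCentre n c) {t : ℤ × ℤ} (htB : t ∈ boxR x₁ x₂ y₁ y₂) (htN : t ∉ tileUnion C)
    (ht2 : t.2 = Y) {x : ℤ} (hx : x₁ ≤ x ∧ x ≤ x₂) (hN : (x, Y) ∈ tileUnion C) :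
    (t.1 < X ∧ X ≤ x) ∨ (x ≤ X ∧ X < t.1) := by
  have htB' := htB
  rw [mem_boxR_iff] at htB'
  have hzB : (x, Y) ∈ boxR x₁ x₂ y₁ y₂ := by rw [mem_boxR_iff]; simp only; omega
  obtain ⟨lo, hi, lo', hi', hxT, hyT, hcov, hwin⟩ := tile_trace_int hF hW hC hN hzB
  simp only at hwin
  have htnot : ¬(lo ≤ t.1 ∧ t.1 ≤ hi) := fun hh =>
    htN (hcov t hh.1 hh.2 (by omega) (by omega) htB'.1 htB'.2.1 htB'.2.2.1 htB'.2.2.2)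
  rcases hxT with h | h | h <;> omega

/-- Position of a target cell on the port COLUMN relative to its quadrant neighbour.
[cite: NewmanTassionWu2017, §3.5 (proof of Lemma 3.16)] -/
theorem quad_pos_col {sx sy X Y : ℤ} (hsx : sx = 1 ∨ sx = -1) (hsy : sy = 1 ∨ sy = -1) {t b' : ℤ × ℤ}
    (hb1 : Side sx X b'.1) (hb2 : Side sy Y b'.2) (hadj : planarAdj b' t) (hcol : t.1 = X) :
    b'.1 = X + sx ∧ b'.2 = t.2 ∧ Side sy Y t.2 := by
  unfold Side at hb1 hb2 ⊢
  simp only [planarAdj, Prod.ext_iff, Prod.fst_add, Prod.snd_add] at hadj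
  rcases hsx with rfl | rfl <;> rcases hsy with rfl | rfl <;> omega

/-- Position of a target cell on the port ROW relative to its quadrant neighbour.
[cite: NewmanTassionWu2017, §3.5 (proof of Lemma 3.16)] -/
theorem quad_pos_row {sx sy X Y : ℤ} (hsx : sx = 1 ∨ sx = -1) (hsy : sy = 1 ∨ sy = -1) {t b' : ℤ × ℤ}
    (hb1 : Side sx X b'.1) (hb2 : Side sy Y b'.2) (htnotK : ¬(Side sx X t.1 ∧ Side sy Y t.2))
    (hadj : planarAdj b' t) (hcol : t.1 ≠ X) :
    t.2 = Y ∧ b'.2 = Y + sy ∧ b'.1 = t.1 ∧ Side sx X t.1 := by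
  unfold Side at hb1 hb2 htnotK ⊢
  simp only [planarAdj, Prod.ext_iff, Prod.fst_add, Prod.snd_add] at hadj
  rcases hsx with rfl | rfl <;> rcases hsy with rfl | rfl <;> omega

/-- In the `quad` layout, next to a cell `t` of `τN ∖ N` adjacent to the free quadrant there is a
second one, adjacent to a different cell of the quadrant (one step along the port line).
[cite: NewmanTassionWu2017, §3.5 (proof of Lemma 3.16, "K_□ … regular enough")] -/
theorem quad_second_pair (hF : IsFrame n p x₁ x₂ y₁ y₂ X Y) (hW : IsFrameND n x₁ x₂ y₁ X Y)
    (hΓ : ∀ g ∈ Γ, 0 ≤ (planar k g).1 ∧ (planar k g).1 ≤ 7 * n ∧ 0 ≤ (planar k g).2)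
    {sx sy a b c d : ℤ} (hsx : sx = 1 ∨ sx = -1) (hsy : sy = 1 ∨ sy = -1)
    (hKx : ∀ x : ℤ, (a ≤ x ∧ x ≤ b) ↔ (x₁ ≤ x ∧ x ≤ x₂ ∧ Side sx X x))
    (hKy : ∀ y : ℤ, (c ≤ y ∧ y ≤ d) ↔ (y₁ ≤ y ∧ y ≤ y₂ ∧ Side sy Y y))
    (hXr : x₁ + 4 ≤ X ∧ X + 4 ≤ x₂) (hYr : y₁ + 4 ≤ Y ∧ Y + 4 ≤ y₂)
    {t b' : ℤ × ℤ} (htB : t ∈ boxR x₁ x₂ y₁ y₂) (htR : t ∈ snapNbhdR k n Γ) (htN : t ∉ snapNbhd k n Γ)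
    (hb1 : Side sx X b'.1) (hb2 : Side sy Y b'.2) (htnotK : ¬(Side sx X t.1 ∧ Side sy Y t.2))
    (hadj : planarAdj b' t) :
    ∃ b₂ t₂ : ℤ × ℤ, b₂ ∈ boxR a b c d ∧ b' ≠ b₂ ∧
      (t₂ ∈ snapNbhdR k n Γ ∧ t₂ ∉ snapNbhd k n Γ ∧ t₂ ∈ boxR x₁ x₂ y₁ y₂) ∧ planarAdj b₂ t₂ := by
  have hCN : ∀ c ∈ snapCentres k n Γ, LatCentre n c := fun c hc => latCentre_snapCentres hΓ hc
  have hCR : ∀ c ∈ snapCentresR k n Γ, LatCentre n c := fun c hc => latCentre_snapCentresR hΓ hc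
  have htB' := htB
  rw [mem_boxR_iff] at htB'
  have htR' : t ∈ tileUnion (snapCentresR k n Γ) := by rw [← snapNbhdR_eq_tileUnion]; exact htR
  have htN' : t ∉ tileUnion (snapCentres k n Γ) := by rw [← snapNbhd_eq_tileUnion]; exact htN
  -- the trace of `t`'s mirror tile (kept packed until the side disjunctions are discharged)
  have htrace := tile_trace_int hF hW hCR htR' htB
  by_cases hcol : t.1 = X
  · -- `t` on the port column
    obtain ⟨hb1', hb2', hty⟩ := quad_pos_col hsx hsy hb1 hb2 hadj hcol
    clear hadj hb1 hb2 htnotK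
    unfold Side at hty
    obtain ⟨lo, hi, lo', hi', hxT, hyT, hcov, hwin⟩ := htrace
    obtain ⟨hw1, hw2, hw3, hw4⟩ := hwin
    have hrows : y₁ ≤ lo' ∧ lo' ≤ Y ∧ Y ≤ hi' ∧ hi' ≤ y₂ ∧ (lo' = y₁ ∨ lo' = Y) ∧ (hi' = y₂ ∨ hi' = Y) := by
      rcases hyT with h | h | h <;> omega
    have hcols : x₁ ≤ lo ∧ lo ≤ X ∧ X ≤ hi ∧ hi ≤ x₂ ∧ (lo = x₁ ∨ lo = X) ∧ (hi = x₂ ∨ hi = X) := by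
      rcases hxT with h | h | h <;> omega
    clear hxT hyT
    have hcovR : ∀ z : ℤ × ℤ, lo ≤ z.1 → z.1 ≤ hi → lo' ≤ z.2 → z.2 ≤ hi' → x₁ ≤ z.1 → z.1 ≤ x₂ →
        y₁ ≤ z.2 → z.2 ≤ y₂ → z ∈ snapNbhdR k n Γ := by
      intro z h1 h2 h3 h4 h5 h6 h7 h8; rw [snapNbhdR_eq_tileUnion]; exact hcov z h1 h2 h3 h4 h5 h6 h7 h8
    clear hcov
    have main : ∃ y : ℤ, y ≠ t.2 ∧ y₁ ≤ y ∧ y ≤ y₂ ∧ lo' ≤ y ∧ y ≤ hi' ∧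
        ((sy = 1 ∧ Y < y) ∨ (sy = -1 ∧ y < Y)) ∧ (X, y) ∉ snapNbhd k n Γ := by
      by_cases hin : y₁ ≤ t.2 + sy ∧ t.2 + sy ≤ y₂
      · refine ⟨t.2 + sy, by omega, hin.1, hin.2, by omega, by omega, by omega, fun hN => ?_⟩
        rw [snapNbhd_eq_tileUnion] at hN
        have := sep_col hF hW hCN htB htN' hcol hin hN
        omega
      · have hin' : y₁ ≤ t.2 - sy ∧ t.2 - sy ≤ y₂ := by omega
        refine ⟨t.2 - sy, by omega, hin'.1, hin'.2, by omega, by omega, by omega, fun hN => ?_⟩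
        rw [snapNbhd_eq_tileUnion] at hN
        have := sep_col hF hW hCN htB htN' hcol hin' hN
        omega
    obtain ⟨y, hyne, hy1, hy2, hy3, hy4, hys, hyN⟩ := main
    have hyR : (X, y) ∈ snapNbhdR k n Γ :=
      hcovR (X, y) (by simp only; omega) (by simp only; omega) (by simp only; omega) (by simp only; omega)
        (by simp only; omega) (by simp only; omega) (by simp only; omega) (by simp only; omega)
    have hyB : (X, y) ∈ boxR x₁ x₂ y₁ y₂ := by rw [mem_boxR_iff]; simp only; omega
    have hcy : c ≤ y ∧ y ≤ d := (hKy y).2 ⟨hy1, hy2, by unfold Side; exact hys⟩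
    have hax : a ≤ X + sx ∧ X + sx ≤ b := (hKx (X + sx)).2 ⟨by omega, by omega, by unfold Side; omega⟩
    refine ⟨(X + sx, y), (X, y), by rw [mem_boxR_iff]; exact ⟨hax.1, hax.2, hcy.1, hcy.2⟩, ?_,
      ⟨hyR, hyN, hyB⟩, ?_⟩
    · intro h; have := congrArg Prod.snd h; simp only at this; omega
    · simp only [planarAdj, Prod.ext_iff, Prod.fst_add, Prod.snd_add]; omega
  · -- `t` on the port row `y = Y`
    obtain ⟨hrow, hb2', hb1', htx⟩ := quad_pos_row hsx hsy hb1 hb2 htnotK hadj hcol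
    clear hadj hb1 hb2 htnotK
    unfold Side at htx
    obtain ⟨lo, hi, lo', hi', hxT, hyT, hcov, hwin⟩ := htrace
    obtain ⟨hw1, hw2, hw3, hw4⟩ := hwin
    have hrows : y₁ ≤ lo' ∧ lo' ≤ Y ∧ Y ≤ hi' ∧ hi' ≤ y₂ ∧ (lo' = y₁ ∨ lo' = Y) ∧ (hi' = y₂ ∨ hi' = Y) := by
      rcases hyT with h | h | h <;> omega
    have hcols : x₁ ≤ lo ∧ lo ≤ X ∧ X ≤ hi ∧ hi ≤ x₂ ∧ (lo = x₁ ∨ lo = X) ∧ (hi = x₂ ∨ hi = X) := by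
      rcases hxT with h | h | h <;> omega
    clear hxT hyT
    have hcovR : ∀ z : ℤ × ℤ, lo ≤ z.1 → z.1 ≤ hi → lo' ≤ z.2 → z.2 ≤ hi' → x₁ ≤ z.1 → z.1 ≤ x₂ →
        y₁ ≤ z.2 → z.2 ≤ y₂ → z ∈ snapNbhdR k n Γ := by
      intro z h1 h2 h3 h4 h5 h6 h7 h8; rw [snapNbhdR_eq_tileUnion]; exact hcov z h1 h2 h3 h4 h5 h6 h7 h8
    clear hcov
    have main : ∃ x : ℤ, x ≠ t.1 ∧ x₁ ≤ x ∧ x ≤ x₂ ∧ lo ≤ x ∧ x ≤ hi ∧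
        ((sx = 1 ∧ X < x) ∨ (sx = -1 ∧ x < X)) ∧ (x, Y) ∉ snapNbhd k n Γ := by
      by_cases hin : x₁ ≤ t.1 + sx ∧ t.1 + sx ≤ x₂
      · refine ⟨t.1 + sx, by omega, hin.1, hin.2, by omega, by omega, by omega, fun hN => ?_⟩
        rw [snapNbhd_eq_tileUnion] at hN
        have := sep_row hF hW hCN htB htN' hrow hin hN
        omega
      · have hin' : x₁ ≤ t.1 - sx ∧ t.1 - sx ≤ x₂ := by omega
        refine ⟨t.1 - sx, by omega, hin'.1, hin'.2, by omega, by omega, by omega, fun hN => ?_⟩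
        rw [snapNbhd_eq_tileUnion] at hN
        have := sep_row hF hW hCN htB htN' hrow hin' hN
        omega
    obtain ⟨x, hxne, hx1, hx2, hx3, hx4, hxs, hxN⟩ := main
    have hxR : (x, Y) ∈ snapNbhdR k n Γ :=
      hcovR (x, Y) (by simp only; omega) (by simp only; omega) (by simp only; omega) (by simp only; omega)
        (by simp only; omega) (by simp only; omega) (by simp only; omega) (by simp only; omega)
    have hxB : (x, Y) ∈ boxR x₁ x₂ y₁ y₂ := by rw [mem_boxR_iff]; simp only; omega
    have hax : a ≤ x ∧ x ≤ b := (hKx x).2 ⟨hx1, hx2, by unfold Side; exact hxs⟩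
    have hcy : c ≤ Y + sy ∧ Y + sy ≤ d := (hKy (Y + sy)).2 ⟨by omega, by omega, by unfold Side; omega⟩
    refine ⟨(x, Y + sy), (x, Y), by rw [mem_boxR_iff]; exact ⟨hax.1, hax.2, hcy.1, hcy.2⟩, ?_,
      ⟨hxR, hxN, hxB⟩, ?_⟩
    · intro h; have := congrArg Prod.fst h; simp only at this; omega
    · simp only [planarAdj, Prod.ext_iff, Prod.fst_add, Prod.snd_add]; omega

end QuadPairs

namespace LocalCtx

variable {n : ℕ} {hn : 1 ≤ n} {Γ : List (slab 3 k)} {ω : BondConfig (slab 3 k)} {p : ℤ × ℤ}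
  {x₁ x₂ y₁ y₂ X Y : ℤ} {gs u g₀ c₀ q : slab 3 k} {l : List (slab 3 k)}
  (ctx : LocalCtx k n hn Γ ω p x₁ x₂ y₁ y₂ X Y gs u g₀ c₀ q l)
include ctx

/-- The local modification from routing data (`gadget_of_local` with the context unpacked).
[cite: NewmanTassionWu2017, §3.5 (proof of Lemma 3.16)] -/
theorem gadget {K : Set (ℤ × ℤ)} (hKB : K ⊆ boxR x₁ x₂ y₁ y₂)
    (hKM : ∀ z ∈ K, z ∉ snapNbhd k n Γ ∧ z ∉ snapNbhdR k n Γ) (hpK : p ∈ K)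
    (hroute : ∀ (E₁ E₂ w : slab 3 k), planar k E₁ ∈ K → planar k E₂ ∈ K → planar k w ∈ K → E₁ ≠ E₂ →
      planar k E₁ ≠ planar k w → planar k E₂ ≠ planar k w → ∃ L Br c, RouteSpec k K K E₁ E₂ w L Br c)
    (hZ : ∀ g : ℤ × ℤ, (g = p ∨ (g ∈ snapNbhd k n Γ ∪ snapNbhdR k n Γ ∧ planarAdj p g)) →
      ∀ z ∈ boxR x₁ x₂ y₁ y₂, z ∈ sqBox g 1 → z ∈ K ∨ z ∈ snapNbhd k n Γ ∪ snapNbhdR k n Γ)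
    (hchainM : ∀ t : ℤ × ℤ, t ∈ snapNbhd k n Γ ∪ snapNbhdR k n Γ → t ∈ boxR x₁ x₂ y₁ y₂ → t ∉ K →
      ∀ f₁ f₂ : ℤ × ℤ, ∃ e m : ℤ × ℤ, e ∈ K ∧ e ≠ f₁ ∧ e ≠ f₂ ∧ planarAdj e m ∧
        ∃ l' : List (ℤ × ℤ), PPath l' m t ∧
          ∀ z ∈ l', (z ∈ snapNbhd k n Γ ∪ snapNbhdR k n Γ ∧ z ∈ boxR x₁ x₂ y₁ y₂) ∧ z ∉ K)
    (hchainN : (∀ t ∈ boxR x₁ x₂ y₁ y₂, t ∈ snapNbhdR k n Γ → t ∉ snapNbhd k n Γ → ∀ b ∈ K, ¬planarAdj b t) →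
      ∀ t : ℤ × ℤ, t ∈ snapNbhd k n Γ → t ∈ boxR x₁ x₂ y₁ y₂ → t ∉ K →
      ∀ f₁ f₂ : ℤ × ℤ, ∃ e m : ℤ × ℤ, e ∈ K ∧ e ≠ f₁ ∧ e ≠ f₂ ∧ planarAdj e m ∧
        ∃ l' : List (ℤ × ℤ), PPath l' m t ∧ ∀ z ∈ l', (z ∈ snapNbhd k n Γ ∧ z ∈ boxR x₁ x₂ y₁ y₂) ∧ z ∉ K)
    (hpairs : (∃ t ∈ boxR x₁ x₂ y₁ y₂, t ∈ snapNbhdR k n Γ ∧ t ∉ snapNbhd k n Γ ∧ ∃ b ∈ K, planarAdj b t) →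
      ∃ b₁ t₁ b₂ t₂ : ℤ × ℤ, b₁ ∈ K ∧ b₂ ∈ K ∧ b₁ ≠ b₂ ∧
        (t₁ ∈ snapNbhdR k n Γ ∧ t₁ ∉ snapNbhd k n Γ ∧ t₁ ∈ boxR x₁ x₂ y₁ y₂) ∧
        (t₂ ∈ snapNbhdR k n Γ ∧ t₂ ∉ snapNbhd k n Γ ∧ t₂ ∈ boxR x₁ x₂ y₁ y₂) ∧
        planarAdj b₁ t₁ ∧ planarAdj b₂ t₂) :
    ∃ ω', GadgetSpec (snapGlue k n hn Γ) k 14 ω ω' :=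
  gadget_of_local hn ctx.hk ctx.hΓ ctx.hω ctx.hX ctx.hF ctx.hW ctx.hpM ctx.hBA ctx.hBC hKB hKM hpK hroute
    hZ hchainM hchainN hpairs ctx.hgs ctx.hgsp ctx.hgsl ctx.hu ctx.hugs ctx.huadj ctx.hg₀ ctx.hg₀gs
    ctx.hc₀ ctx.hch ctx.hnd ctx.hsub ctx.hhead ctx.hfar ctx.hl ctx.hqg₀

/-- Lattice centres of `M`. [cite: NewmanTassionWu2017, §3.5 (proof of Lemma 3.16)] -/
theorem latCentre_M : ∀ c ∈ snapCentres k n Γ ∪ snapCentresR k n Γ, LatCentre n c :=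
  fun _ hc => latCentre_union ctx.hΓ hc

/-- Lattice centres of `N`. [cite: NewmanTassionWu2017, §3.5 (proof of Lemma 3.16)] -/
theorem latCentre_N : ∀ c ∈ snapCentres k n Γ, LatCentre n c :=
  fun _ hc => latCentre_snapCentres ctx.hΓ hc

/-! ## Layout `clear`: route in the whole box -/

/-- **Layout `clear`**: no tile meets the box; plain surgery routed in the whole box.
[cite: NewmanTassionWu2017, §3.2 (proof of Theorem 3.7, steps (1)–(3))] -/
theorem gadget_clear (h : ∀ z ∈ boxR x₁ x₂ y₁ y₂, z ∉ snapNbhd k n Γ ∪ snapNbhdR k n Γ) :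
    ∃ ω', GadgetSpec (snapGlue k n hn Γ) k 14 ω ω' := by
  have hF := ctx.hF
  have hk := ctx.hk
  have hpx₁ := hF.hpx₁; have hpx₂ := hF.hpx₂; have hpy₁ := hF.hpy₁; have hpy₂ := hF.hpy₂
  have hdx₁ := hF.hdx₁; have hdx₂ := hF.hdx₂; have hdy₁ := hF.hdy₁; have hdy₂ := hF.hdy₂
  have hx₁ := hF.hx₁
  refine ctx.gadget subset_rfl (fun z hz => ⟨fun h' => h z hz (Or.inl h'), fun h' => h z hz (Or.inr h')⟩)
    (by rw [mem_boxR_iff]; omega) (fun E₁ E₂ w hE₁ hE₂ hw hne h1 h2 => ?_) (fun g _ z hz _ => Or.inl hz)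
    (fun t ht htB _ => absurd ht (h t htB)) (fun _ t ht htB _ => absurd (Or.inl ht) (h t htB))
    (fun ⟨t, htB, htR, _, _⟩ => absurd (Or.inr htR) (h t htB))
  exact exists_route (xL := x₁) (xR' := x₂) (xR := x₂) (rB := y₁) (rP := y₂) (rT := y₂) hk (by omega)
    le_rfl (by omega) le_rfl hE₁ hE₂ hw hne h1 h2

/-! ## Layout `halfV`: free half-box beside the line `x = X`, which is covered by tiles -/

/-- **Layout `halfV s`**: `K = {x₁ ≤ x ≤ x₂, Side s X x} × [y₁, y₂]`, port column `x = X`.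
[cite: NewmanTassionWu2017, §3.5 (proof of Lemma 3.16, "K_□ … regular enough")] -/
theorem gadget_halfV {s a b : ℤ} (hs : s = 1 ∨ s = -1)
    (hK : ∀ x : ℤ, (a ≤ x ∧ x ≤ b) ↔ (x₁ ≤ x ∧ x ≤ x₂ ∧ Side s X x)) (hab : a + 3 ≤ b)
    (hXr : x₁ + 4 ≤ X ∧ X + 4 ≤ x₂) (hp : Side s X p.1)
    (hU : ∀ z ∈ boxR x₁ x₂ y₁ y₂, z ∈ snapNbhd k n Γ ∪ snapNbhdR k n Γ ↔ SideW (-s) X z.1) :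
    ∃ ω', GadgetSpec (snapGlue k n hn Γ) k 14 ω ω' := by
  have hF := ctx.hF; have hW := ctx.hW; have hk := ctx.hk
  have hpx₁ := hF.hpx₁; have hpx₂ := hF.hpx₂; have hpy₁ := hF.hpy₁; have hpy₂ := hF.hpy₂
  have hdy₂ := hF.hdy₂; have hy₁ := hF.hy₁; have hYle := hF.hYle; have hdy₁ := hF.hdy₁
  have hCM := ctx.latCentre_M
  have hCN := ctx.latCentre_N
  set K : Set (ℤ × ℤ) := boxR a b y₁ y₂ with hKdef
  have memK : ∀ z : ℤ × ℤ, z ∈ K ↔ x₁ ≤ z.1 ∧ z.1 ≤ x₂ ∧ Side s X z.1 ∧ y₁ ≤ z.2 ∧ z.2 ≤ y₂ := by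
    intro z; rw [hKdef, mem_boxR_iff]
    constructor
    · rintro ⟨h1, h2, h3, h4⟩; exact ⟨((hK z.1).1 ⟨h1, h2⟩).1, ((hK z.1).1 ⟨h1, h2⟩).2.1, ((hK z.1).1 ⟨h1, h2⟩).2.2, h3, h4⟩
    · rintro ⟨h1, h2, h3, h4, h5⟩; exact ⟨((hK z.1).2 ⟨h1, h2, h3⟩).1, ((hK z.1).2 ⟨h1, h2, h3⟩).2, h4, h5⟩
  have hKB : K ⊆ boxR x₁ x₂ y₁ y₂ := fun z hz => by
    rw [memK] at hz; rw [mem_boxR_iff]; exact ⟨hz.1, hz.2.1, hz.2.2.2.1, hz.2.2.2.2⟩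
  have hKM : ∀ z ∈ K, z ∉ snapNbhd k n Γ ∧ z ∉ snapNbhdR k n Γ := by
    intro z hz
    have hzB := hKB hz
    rw [memK] at hz
    have : z ∉ snapNbhd k n Γ ∪ snapNbhdR k n Γ := fun h' => by
      have := (hU z hzB).1 h'; unfold Side SideW at *; omega
    exact ⟨fun h' => this (Or.inl h'), fun h' => this (Or.inr h')⟩
  have hKU : ∀ z ∈ K, z ∉ tileUnion (snapCentres k n Γ ∪ snapCentresR k n Γ) := by
    intro z hz; rw [← snapNbhd_union_eq_tileUnion]; exact fun h' => (hKM z hz).elim fun h1 h2 => h'.elim h1 h2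
  have hKUN : ∀ z ∈ K, z ∉ tileUnion (snapCentres k n Γ) := by
    intro z hz; rw [← snapNbhd_eq_tileUnion]; exact (hKM z hz).1
  have hpK : p ∈ K := by rw [memK]; exact ⟨hpx₁, hpx₂, hp, hpy₁, hpy₂⟩
  have hab' : a = min a b := (min_eq_left (by omega)).symm
  -- the entry cells `(X + s, y)`
  have hent : ∀ y : ℤ, y₁ ≤ y → y ≤ y₂ → (X + s, y) ∈ K := by
    intro y h1 h2; rw [memK]; simp only; unfold Side; refine ⟨by omega, by omega, by omega, h1, h2⟩
  -- the port column is covered by `M`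
  have hcolM : ∀ y : ℤ, y₁ ≤ y → y ≤ y₂ → (X, y) ∈ snapNbhd k n Γ ∪ snapNbhdR k n Γ ∧ (X, y) ∈ boxR x₁ x₂ y₁ y₂ := by
    intro y h1 h2
    have hzB : (X, y) ∈ boxR x₁ x₂ y₁ y₂ := by rw [mem_boxR_iff]; simp only; omega
    exact ⟨(hU _ hzB).2 (by unfold SideW; simp only; omega), hzB⟩
  refine ctx.gadget hKB hKM hpK (fun E₁ E₂ w hE₁ hE₂ hw hne h1 h2 => ?_) (fun g _ z hz _ => ?_)
    (fun t ht htB htK f₁ f₂ => ?_) (fun H t ht htB htK f₁ f₂ => ?_) (fun hT => ?_)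
  · -- router
    exact exists_route (xL := a) (xR' := b) (xR := b) (rB := y₁) (rP := y₂) (rT := y₂) hk (by omega)
      le_rfl (by omega) le_rfl hE₁ hE₂ hw hne h1 h2
  · -- closeness: every cell of the box is in `K` or in `M`
    by_cases hzs : Side s X z.1
    · left; rw [memK]; rw [mem_boxR_iff] at hz; exact ⟨hz.1, hz.2.1, hzs, hz.2.2.1, hz.2.2.2⟩
    · right; exact (hU z hz).2 (by unfold Side at hzs; unfold SideW; omega)
  · -- chains through `M`
    rw [snapNbhd_union_eq_tileUnion] at ht ⊢
    exact exists_chain_col hF hCM hKU (by omega) hs (c := y₁) (d := y₂) (by omega) hent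
      (fun y hy1 hy2 => by
        rw [← snapNbhd_union_eq_tileUnion]
        exact hcolM y (by rw [min_def, max_def] at hy1; split_ifs at hy1 <;> omega)
          (by rw [max_def, max_def] at hy2; split_ifs at hy2 <;> omega))
      ht htB f₁ f₂
  · -- chains through `N`, no cell of `τN ∖ N` being adjacent to `K`
    rw [snapNbhd_eq_tileUnion] at ht ⊢
    refine exists_chain_col hF hCN hKUN (by omega) hs (c := y₁) (d := y₂) (by omega) hent
      (fun y hy1 hy2 => ?_) ht htB f₁ f₂
    have hy1' : y₁ ≤ y := by rw [min_def, max_def] at hy1; split_ifs at hy1 <;> omega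
    have hy2' : y ≤ y₂ := by rw [max_def, max_def] at hy2; split_ifs at hy2 <;> omega
    obtain ⟨hM, hB'⟩ := hcolM y hy1' hy2'
    refine ⟨?_, hB'⟩
    rw [← snapNbhd_eq_tileUnion]
    by_contra hN
    rcases hM with hN' | hR
    · exact hN hN'
    · exact H _ hB' hR hN _ (hent y hy1' hy2') (by simp only [planarAdj, Prod.ext_iff, Prod.fst_add, Prod.snd_add]; omega)
  · -- two target pairs on the port column
    obtain ⟨t, htB, htR, htN, b', hb', hadj⟩ := hT
    have hb'K := hb'
    rw [memK] at hb'
    have htB' := htB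
    rw [mem_boxR_iff] at htB'
    have htU : SideW (-s) X t.1 := (hU t htB).1 (Or.inr htR)
    have ht1 : t.1 = X ∧ b' = (X + s, t.2) := by
      unfold Side at hb'; unfold SideW at htU
      simp only [planarAdj, Prod.ext_iff, Prod.fst_add, Prod.snd_add] at hadj
      refine ⟨by omega, Prod.ext ?_ ?_⟩ <;> simp only <;> omega
    -- traces through `t`: of a tile of `τN` (containing `t`) and, hypothetically, of tiles of `N`
    have htR' : t ∈ tileUnion (snapCentresR k n Γ) := by rw [← snapNbhdR_eq_tileUnion]; exact htR
    have hCR : ∀ c ∈ snapCentresR k n Γ, LatCentre n c := fun c hc => latCentre_snapCentresR ctx.hΓ hc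
    obtain ⟨lo, hi, lo', hi', hxT, hyT, hcov, hwin⟩ := tile_trace_int hF hW hCR htR' htB
    -- membership of `(X, y)` in `N` forces the line `Y` next to `t`
    have hNrow : ∀ y : ℤ, y₁ ≤ y → y ≤ y₂ → (X, y) ∈ snapNbhd k n Γ → (y = t.2 + 1 → Y = t.2 + 1) ∧
        (y = t.2 - 1 → Y = t.2 - 1) := by
      intro y h1 h2 hN
      rw [snapNbhd_eq_tileUnion] at hN htN
      have hzB : (X, y) ∈ boxR x₁ x₂ y₁ y₂ := by rw [mem_boxR_iff]; simp only; omega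
      obtain ⟨lo₂, hi₂, lo₂', hi₂', hxT₂, hyT₂, hcov₂, hwin₂⟩ := tile_trace_int hF hW hCN hN hzB
      simp only at hwin₂
      have htnot : ¬(lo₂ ≤ t.1 ∧ t.1 ≤ hi₂ ∧ lo₂' ≤ t.2 ∧ t.2 ≤ hi₂') := fun hh =>
        htN (hcov₂ t hh.1 hh.2.1 hh.2.2.1 hh.2.2.2 htB'.1 htB'.2.1 htB'.2.2.1 htB'.2.2.2)
      constructor <;> intro hy <;> omega
    -- choose the neighbour row
    have hty1 : y₁ ≤ t.2 := htB'.2.2.1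
    have hty2 : t.2 ≤ y₂ := htB'.2.2.2
    have hw3 : lo' ≤ t.2 := hwin.2.2.1
    have hw4 : t.2 ≤ hi' := hwin.2.2.2
    have hrows : lo' + 4 ≤ hi' ∧ y₁ ≤ lo' ∧ hi' ≤ y₂ ∧ (hi' = y₂ ∨ hi' = Y) ∧ (lo' = y₁ ∨ lo' = Y) := by
      rcases hyT with ⟨h1, h2⟩ | ⟨h1, h2, h3, h4⟩ | ⟨h1, h2, h3, h4⟩
      · refine ⟨by omega, by omega, by omega, Or.inl h2, Or.inl h1⟩
      · refine ⟨by omega, by omega, by omega, Or.inr h2, Or.inl h1⟩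
      · refine ⟨by omega, by omega, by omega, Or.inl h2, Or.inr h1⟩
    obtain ⟨hr1, hr2, hr3, hr4, hr5⟩ := hrows
    have hYint : Y = y₁ - 1 ∨ Y = y₁ ∨ (y₁ + 4 ≤ Y ∧ Y ≤ y₂ - 4) := hF.hY
    have main : ∃ y : ℤ, (y = t.2 + 1 ∨ y = t.2 - 1) ∧ y₁ ≤ y ∧ y ≤ y₂ ∧ lo' ≤ y ∧ y ≤ hi' ∧
        (X, y) ∉ snapNbhd k n Γ := by
      by_cases hA : t.2 + 1 ≤ hi' ∧ (X, t.2 + 1) ∉ snapNbhd k n Γ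
      · exact ⟨t.2 + 1, Or.inl rfl, by omega, by omega, by omega, hA.1, hA.2⟩
      · have hB : t.2 = hi' ∨ Y = t.2 + 1 := by
          by_cases hup : t.2 + 1 ≤ hi'
          · right
            have hN1 : (X, t.2 + 1) ∈ snapNbhd k n Γ := by
              by_contra h; exact hA ⟨hup, h⟩
            exact (hNrow (t.2 + 1) (by omega) (by omega) hN1).1 rfl
          · left; omega
        have hlow : y₁ ≤ t.2 - 1 ∧ lo' ≤ t.2 - 1 := by
          rcases hB with h | h
          · constructor <;> omega
          · rcases hYint with h' | h' | h'
            · omega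
            · omega
            · rcases hr5 with h5 | h5 <;> constructor <;> omega
        refine ⟨t.2 - 1, Or.inr rfl, hlow.1, by omega, hlow.2, by omega, fun hN2 => ?_⟩
        have h2 := (hNrow (t.2 - 1) hlow.1 (by omega) hN2).2 rfl
        rcases hB with h | h
        · rcases hr4 with h4 | h4 <;> rcases hYint with h' | h' | h' <;> omega
        · omega
    obtain ⟨y, hy, hy1, hy2, hy3, hy4, hyN⟩ := main
    have hyR : (X, y) ∈ snapNbhdR k n Γ := by
      rw [snapNbhdR_eq_tileUnion]
      exact hcov (X, y) (by simp only; omega) (by simp only; omega) (by simp only; omega) (by simp only; omega)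
        (by simp only; omega) (by simp only; omega) (by simp only; omega) (by simp only; omega)
    have hyB : (X, y) ∈ boxR x₁ x₂ y₁ y₂ := by rw [mem_boxR_iff]; simp only; omega
    refine ⟨b', t, (X + s, y), (X, y), hb'K, hent y hy1 hy2, ?_, ⟨htR, htN, htB⟩, ⟨hyR, hyN, hyB⟩, hadj, ?_⟩
    · rw [ht1.2]; intro h; have := congrArg Prod.snd h; simp only at this; omega
    · simp only [planarAdj, Prod.ext_iff, Prod.fst_add, Prod.snd_add]; omega

/-! ## Layout `halfH`: free half-box beside the line `y = Y`, which is covered by tiles -/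

/-- **Layout `halfH s`**: `K = [x₁, x₂] × {y₁ ≤ y ≤ y₂, Side s Y y}`, port row `y = Y`.
[cite: NewmanTassionWu2017, §3.5 (proof of Lemma 3.16, "K_□ … regular enough")] -/
theorem gadget_halfH {s c d : ℤ} (hs : s = 1 ∨ s = -1)
    (hK : ∀ y : ℤ, (c ≤ y ∧ y ≤ d) ↔ (y₁ ≤ y ∧ y ≤ y₂ ∧ Side s Y y)) (hcd : c + 3 ≤ d)
    (hYr : y₁ + 4 ≤ Y ∧ Y + 4 ≤ y₂) (hp : Side s Y p.2)
    (hU : ∀ z ∈ boxR x₁ x₂ y₁ y₂, z ∈ snapNbhd k n Γ ∪ snapNbhdR k n Γ ↔ SideW (-s) Y z.2) :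
    ∃ ω', GadgetSpec (snapGlue k n hn Γ) k 14 ω ω' := by
  have hF := ctx.hF; have hW := ctx.hW; have hk := ctx.hk
  have hpx₁ := hF.hpx₁; have hpx₂ := hF.hpx₂; have hpy₁ := hF.hpy₁; have hpy₂ := hF.hpy₂
  have hdx₂ := hF.hdx₂; have hx₁ := hF.hx₁; have hXle := hF.hXle; have hdx₁ := hF.hdx₁
  have hCM := ctx.latCentre_M
  have hCN := ctx.latCentre_N
  set K : Set (ℤ × ℤ) := boxR x₁ x₂ c d with hKdef
  have memK : ∀ z : ℤ × ℤ, z ∈ K ↔ x₁ ≤ z.1 ∧ z.1 ≤ x₂ ∧ y₁ ≤ z.2 ∧ z.2 ≤ y₂ ∧ Side s Y z.2 := by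
    intro z; rw [hKdef, mem_boxR_iff]
    constructor
    · rintro ⟨h1, h2, h3, h4⟩
      exact ⟨h1, h2, ((hK z.2).1 ⟨h3, h4⟩).1, ((hK z.2).1 ⟨h3, h4⟩).2.1, ((hK z.2).1 ⟨h3, h4⟩).2.2⟩
    · rintro ⟨h1, h2, h3, h4, h5⟩; exact ⟨h1, h2, ((hK z.2).2 ⟨h3, h4, h5⟩).1, ((hK z.2).2 ⟨h3, h4, h5⟩).2⟩
  have hKB : K ⊆ boxR x₁ x₂ y₁ y₂ := fun z hz => by
    rw [memK] at hz; rw [mem_boxR_iff]; exact ⟨hz.1, hz.2.1, hz.2.2.1, hz.2.2.2.1⟩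
  have hKM : ∀ z ∈ K, z ∉ snapNbhd k n Γ ∧ z ∉ snapNbhdR k n Γ := by
    intro z hz
    have hzB := hKB hz
    rw [memK] at hz
    have : z ∉ snapNbhd k n Γ ∪ snapNbhdR k n Γ := fun h' => by
      have := (hU z hzB).1 h'; unfold Side SideW at *; omega
    exact ⟨fun h' => this (Or.inl h'), fun h' => this (Or.inr h')⟩
  have hKU : ∀ z ∈ K, z ∉ tileUnion (snapCentres k n Γ ∪ snapCentresR k n Γ) := by
    intro z hz; rw [← snapNbhd_union_eq_tileUnion]; exact fun h' => (hKM z hz).elim fun h1 h2 => h'.elim h1 h2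
  have hKUN : ∀ z ∈ K, z ∉ tileUnion (snapCentres k n Γ) := by
    intro z hz; rw [← snapNbhd_eq_tileUnion]; exact (hKM z hz).1
  have hpK : p ∈ K := by rw [memK]; exact ⟨hpx₁, hpx₂, hpy₁, hpy₂, hp⟩
  -- the entry cells `(x, Y + s)`
  have hent : ∀ x : ℤ, x₁ ≤ x → x ≤ x₂ → (x, Y + s) ∈ K := by
    intro x h1 h2; rw [memK]; simp only; unfold Side; refine ⟨h1, h2, by omega, by omega, by omega⟩
  -- the port row is covered by `M`
  have hrowM : ∀ x : ℤ, x₁ ≤ x → x ≤ x₂ →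
      (x, Y) ∈ snapNbhd k n Γ ∪ snapNbhdR k n Γ ∧ (x, Y) ∈ boxR x₁ x₂ y₁ y₂ := by
    intro x h1 h2
    have hzB : (x, Y) ∈ boxR x₁ x₂ y₁ y₂ := by rw [mem_boxR_iff]; simp only; omega
    exact ⟨(hU _ hzB).2 (by unfold SideW; simp only; omega), hzB⟩
  refine ctx.gadget hKB hKM hpK (fun E₁ E₂ w hE₁ hE₂ hw hne h1 h2 => ?_) (fun g _ z hz _ => ?_)
    (fun t ht htB htK f₁ f₂ => ?_) (fun H t ht htB htK f₁ f₂ => ?_) (fun hT => ?_)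
  · exact exists_route (xL := x₁) (xR' := x₂) (xR := x₂) (rB := c) (rP := d) (rT := d) hk (by omega)
      le_rfl (by omega) le_rfl hE₁ hE₂ hw hne h1 h2
  · by_cases hzs : Side s Y z.2
    · left; rw [memK]; rw [mem_boxR_iff] at hz; exact ⟨hz.1, hz.2.1, hz.2.2.1, hz.2.2.2, hzs⟩
    · right; exact (hU z hz).2 (by unfold Side at hzs; unfold SideW; omega)
  · rw [snapNbhd_union_eq_tileUnion] at ht ⊢
    exact exists_chain_row hF hCM hKU (by omega) hs (c := x₁) (d := x₂) (by omega) hent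
      (fun x hx1 hx2 => by
        rw [← snapNbhd_union_eq_tileUnion]
        exact hrowM x (by rw [min_def, max_def] at hx1; split_ifs at hx1 <;> omega)
          (by rw [max_def, max_def] at hx2; split_ifs at hx2 <;> omega))
      ht htB f₁ f₂
  · rw [snapNbhd_eq_tileUnion] at ht ⊢
    refine exists_chain_row hF hCN hKUN (by omega) hs (c := x₁) (d := x₂) (by omega) hent
      (fun x hx1 hx2 => ?_) ht htB f₁ f₂
    have hx1' : x₁ ≤ x := by rw [min_def, max_def] at hx1; split_ifs at hx1 <;> omega
    have hx2' : x ≤ x₂ := by rw [max_def, max_def] at hx2; split_ifs at hx2 <;> omega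
    obtain ⟨hM, hB'⟩ := hrowM x hx1' hx2'
    refine ⟨?_, hB'⟩
    rw [← snapNbhd_eq_tileUnion]
    by_contra hN
    rcases hM with hN' | hR
    · exact hN hN'
    · exact H _ hB' hR hN _ (hent x hx1' hx2') (by simp only [planarAdj, Prod.ext_iff, Prod.fst_add, Prod.snd_add]; omega)
  · obtain ⟨t, htB, htR, htN, b', hb', hadj⟩ := hT
    have hb'K := hb'
    rw [memK] at hb'
    have htB' := htB
    rw [mem_boxR_iff] at htB'
    have htU : SideW (-s) Y t.2 := (hU t htB).1 (Or.inr htR)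
    have ht1 : t.2 = Y ∧ b' = (t.1, Y + s) := by
      unfold Side at hb'; unfold SideW at htU
      simp only [planarAdj, Prod.ext_iff, Prod.fst_add, Prod.snd_add] at hadj
      refine ⟨by omega, Prod.ext ?_ ?_⟩ <;> simp only <;> omega
    have htR' : t ∈ tileUnion (snapCentresR k n Γ) := by rw [← snapNbhdR_eq_tileUnion]; exact htR
    have hCR : ∀ c ∈ snapCentresR k n Γ, LatCentre n c := fun c hc => latCentre_snapCentresR ctx.hΓ hc
    obtain ⟨lo, hi, lo', hi', hxT, hyT, hcov, hwin⟩ := tile_trace_int hF hW hCR htR' htB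
    have hNcol : ∀ x : ℤ, x₁ ≤ x → x ≤ x₂ → (x, Y) ∈ snapNbhd k n Γ → (x = t.1 + 1 → X = t.1 + 1) ∧
        (x = t.1 - 1 → X = t.1 - 1) := by
      intro x h1 h2 hN
      rw [snapNbhd_eq_tileUnion] at hN htN
      have hzB : (x, Y) ∈ boxR x₁ x₂ y₁ y₂ := by rw [mem_boxR_iff]; simp only; omega
      obtain ⟨lo₂, hi₂, lo₂', hi₂', hxT₂, hyT₂, hcov₂, hwin₂⟩ := tile_trace_int hF hW hCN hN hzB
      simp only at hwin₂
      have htnot : ¬(lo₂ ≤ t.1 ∧ t.1 ≤ hi₂ ∧ lo₂' ≤ t.2 ∧ t.2 ≤ hi₂') := fun hh =>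
        htN (hcov₂ t hh.1 hh.2.1 hh.2.2.1 hh.2.2.2 htB'.1 htB'.2.1 htB'.2.2.1 htB'.2.2.2)
      constructor <;> intro hx <;> omega
    have htx1 : x₁ ≤ t.1 := htB'.1
    have htx2 : t.1 ≤ x₂ := htB'.2.1
    have hw1 : lo ≤ t.1 := hwin.1
    have hw2 : t.1 ≤ hi := hwin.2.1
    have hcols : lo + 4 ≤ hi ∧ x₁ ≤ lo ∧ hi ≤ x₂ ∧ (hi = x₂ ∨ hi = X) ∧ (lo = x₁ ∨ lo = X) := by
      rcases hxT with ⟨h1, h2⟩ | ⟨h1, h2, h3, h4⟩ | ⟨h1, h2, h3, h4⟩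
      · refine ⟨by omega, by omega, by omega, Or.inl h2, Or.inl h1⟩
      · refine ⟨by omega, by omega, by omega, Or.inr h2, Or.inl h1⟩
      · refine ⟨by omega, by omega, by omega, Or.inl h2, Or.inr h1⟩
    obtain ⟨hr1, hr2, hr3, hr4, hr5⟩ := hcols
    have hXint : X = x₁ - 1 ∨ X = x₁ ∨ X = x₂ ∨ (x₁ + 4 ≤ X ∧ X ≤ x₂ - 4) := hF.hX
    have main : ∃ x : ℤ, (x = t.1 + 1 ∨ x = t.1 - 1) ∧ x₁ ≤ x ∧ x ≤ x₂ ∧ lo ≤ x ∧ x ≤ hi ∧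
        (x, Y) ∉ snapNbhd k n Γ := by
      by_cases hA : t.1 + 1 ≤ hi ∧ (t.1 + 1, Y) ∉ snapNbhd k n Γ
      · exact ⟨t.1 + 1, Or.inl rfl, by omega, by omega, by omega, hA.1, hA.2⟩
      · have hB : t.1 = hi ∨ X = t.1 + 1 := by
          by_cases hup : t.1 + 1 ≤ hi
          · right
            have hN1 : (t.1 + 1, Y) ∈ snapNbhd k n Γ := by
              by_contra h; exact hA ⟨hup, h⟩
            exact (hNcol (t.1 + 1) (by omega) (by omega) hN1).1 rfl
          · left; omega
        have hlow : x₁ ≤ t.1 - 1 ∧ lo ≤ t.1 - 1 := by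
          rcases hB with h | h
          · constructor <;> omega
          · rcases hXint with h' | h' | h' | h'
            · omega
            · omega
            · rcases hr5 with h5 | h5 <;> constructor <;> omega
            · rcases hr5 with h5 | h5 <;> constructor <;> omega
        refine ⟨t.1 - 1, Or.inr rfl, hlow.1, by omega, hlow.2, by omega, fun hN2 => ?_⟩
        have h2 := (hNcol (t.1 - 1) hlow.1 (by omega) hN2).2 rfl
        rcases hB with h | h
        · rcases hr4 with h4 | h4 <;> rcases hXint with h' | h' | h' | h' <;> omega
        · omega
    obtain ⟨x, hx, hx1, hx2, hx3, hx4, hxN⟩ := main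
    have hty : lo' ≤ t.2 ∧ t.2 ≤ hi' := ⟨hwin.2.2.1, hwin.2.2.2⟩
    have hxR : (x, Y) ∈ snapNbhdR k n Γ := by
      rw [snapNbhdR_eq_tileUnion]
      exact hcov (x, Y) (by simp only; omega) (by simp only; omega) (by simp only; omega) (by simp only; omega)
        (by simp only; omega) (by simp only; omega) (by simp only; omega) (by simp only; omega)
    have hxB : (x, Y) ∈ boxR x₁ x₂ y₁ y₂ := by rw [mem_boxR_iff]; simp only; omega
    refine ⟨b', t, (x, Y + s), (x, Y), hb'K, hent x hx1 hx2, ?_, ⟨htR, htN, htB⟩, ⟨hxR, hxN, hxB⟩, hadj, ?_⟩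
    · rw [ht1.2]; intro h; have := congrArg Prod.fst h; simp only at this; omega
    · simp only [planarAdj, Prod.ext_iff, Prod.fst_add, Prod.snd_add]; omega

/-! ## Layout `quad`: free open quadrant; the two closed quadrants across the lines are tiles -/

/-- **Layout `quad sx sy`**: `K = {Side sx X x} × {Side sy Y y}` (inside the box), port column
`x = X` on the side `sy` of `Y`. [cite: NewmanTassionWu2017, §3.5 (proof of Lemma 3.16, "K_□ … regular enough")] -/
theorem gadget_quad {sx sy a b c d : ℤ} (hsx : sx = 1 ∨ sx = -1) (hsy : sy = 1 ∨ sy = -1)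
    (hKx : ∀ x : ℤ, (a ≤ x ∧ x ≤ b) ↔ (x₁ ≤ x ∧ x ≤ x₂ ∧ Side sx X x))
    (hKy : ∀ y : ℤ, (c ≤ y ∧ y ≤ d) ↔ (y₁ ≤ y ∧ y ≤ y₂ ∧ Side sy Y y))
    (hab : a + 3 ≤ b) (hcd : c + 3 ≤ d) (hXr : x₁ + 4 ≤ X ∧ X + 4 ≤ x₂) (hYr : y₁ + 4 ≤ Y ∧ Y + 4 ≤ y₂)
    (hp : Side sx X p.1 ∧ Side sy Y p.2)
    (hfree : ∀ z ∈ boxR x₁ x₂ y₁ y₂, Side sx X z.1 → Side sy Y z.2 → z ∉ snapNbhd k n Γ ∪ snapNbhdR k n Γ)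
    (hUV : ∀ z ∈ boxR x₁ x₂ y₁ y₂, SideW (-sx) X z.1 → SideW sy Y z.2 → z ∈ snapNbhd k n Γ ∪ snapNbhdR k n Γ)
    (hUH : ∀ z ∈ boxR x₁ x₂ y₁ y₂, SideW sx X z.1 → SideW (-sy) Y z.2 → z ∈ snapNbhd k n Γ ∪ snapNbhdR k n Γ) :
    ∃ ω', GadgetSpec (snapGlue k n hn Γ) k 14 ω ω' := by
  have hF := ctx.hF; have hW := ctx.hW; have hk := ctx.hk
  have hpx₁ := hF.hpx₁; have hpx₂ := hF.hpx₂; have hpy₁ := hF.hpy₁; have hpy₂ := hF.hpy₂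
  have hCM := ctx.latCentre_M
  have hCN := ctx.latCentre_N
  obtain ⟨hc1, hc2⟩ : (y₁ ≤ c ∧ c ≤ y₂ ∧ Side sy Y c) ∧ (y₁ ≤ d ∧ d ≤ y₂ ∧ Side sy Y d) :=
    ⟨(hKy c).1 ⟨le_rfl, by omega⟩, (hKy d).1 ⟨by omega, le_rfl⟩⟩
  obtain ⟨ha1, ha2⟩ : (x₁ ≤ a ∧ a ≤ x₂ ∧ Side sx X a) ∧ (x₁ ≤ b ∧ b ≤ x₂ ∧ Side sx X b) :=
    ⟨(hKx a).1 ⟨le_rfl, by omega⟩, (hKx b).1 ⟨by omega, le_rfl⟩⟩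
  set K : Set (ℤ × ℤ) := boxR a b c d with hKdef
  have memK : ∀ z : ℤ × ℤ, z ∈ K ↔ (x₁ ≤ z.1 ∧ z.1 ≤ x₂ ∧ Side sx X z.1) ∧ (y₁ ≤ z.2 ∧ z.2 ≤ y₂ ∧ Side sy Y z.2) := by
    intro z; rw [hKdef, mem_boxR_iff, ← hKx z.1, ← hKy z.2]; tauto
  have hKB : K ⊆ boxR x₁ x₂ y₁ y₂ := fun z hz => by
    rw [memK] at hz; rw [mem_boxR_iff]; exact ⟨hz.1.1, hz.1.2.1, hz.2.1, hz.2.2.1⟩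
  have hKM : ∀ z ∈ K, z ∉ snapNbhd k n Γ ∧ z ∉ snapNbhdR k n Γ := by
    intro z hz
    have hzB := hKB hz
    rw [memK] at hz
    have := hfree z hzB hz.1.2.2 hz.2.2.2
    exact ⟨fun h' => this (Or.inl h'), fun h' => this (Or.inr h')⟩
  have hKU : ∀ z ∈ K, z ∉ tileUnion (snapCentres k n Γ ∪ snapCentresR k n Γ) := by
    intro z hz; rw [← snapNbhd_union_eq_tileUnion]; exact fun h' => (hKM z hz).elim fun h1 h2 => h'.elim h1 h2
  have hKUN : ∀ z ∈ K, z ∉ tileUnion (snapCentres k n Γ) := by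
    intro z hz; rw [← snapNbhd_eq_tileUnion]; exact (hKM z hz).1
  have hpK : p ∈ K := by rw [memK]; exact ⟨⟨hpx₁, hpx₂, hp.1⟩, ⟨hpy₁, hpy₂, hp.2⟩⟩
  -- the entry cells `(X + sx, y)`, `c ≤ y ≤ d`
  have hent : ∀ y : ℤ, c ≤ y → y ≤ d → (X + sx, y) ∈ K := by
    intro y h1 h2
    rw [memK]; simp only
    refine ⟨⟨by omega, by omega, by unfold Side; omega⟩, (hKy y).1 ⟨h1, h2⟩⟩
  -- the port column: `(X, y)` for `y` weakly on the side `sy` of `Y`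
  have hcolM : ∀ y : ℤ, min c (max y₁ Y) ≤ y → y ≤ max d (max y₁ Y) →
      (X, y) ∈ snapNbhd k n Γ ∪ snapNbhdR k n Γ ∧ (X, y) ∈ boxR x₁ x₂ y₁ y₂ ∧ SideW sy Y y := by
    intro y hy1 hy2
    have hc1' := hc1.2.2; have hc2' := hc2.2.2
    unfold Side at hc1' hc2'
    have hsw : SideW sy Y y ∧ y₁ ≤ y ∧ y ≤ y₂ := by
      unfold SideW
      rw [min_def, max_def] at hy1; rw [max_def, max_def] at hy2
      split_ifs at hy1 hy2 <;> omega
    have hzB : (X, y) ∈ boxR x₁ x₂ y₁ y₂ := by rw [mem_boxR_iff]; simp only; omega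
    exact ⟨hUV _ hzB (by unfold SideW; simp only; omega) hsw.1, hzB, hsw.1⟩
  refine ctx.gadget hKB hKM hpK (fun E₁ E₂ w hE₁ hE₂ hw hne h1 h2 => ?_) (fun g hg z hz hzg => ?_)
    (fun t ht htB htK f₁ f₂ => ?_) (fun H t ht htB htK f₁ f₂ => ?_) (fun hT => ?_)
  · exact exists_route (xL := a) (xR' := b) (xR := b) (rB := c) (rP := d) (rT := d) hk (by omega)
      le_rfl (by omega) le_rfl hE₁ hE₂ hw hne h1 h2
  · -- closeness
    have hzB := hz
    rw [mem_boxR_iff] at hz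
    rw [mem_sqBox_iff'] at hzg
    push_cast at hzg
    have hp1 := hp.1; have hp2 := hp.2
    unfold Side at hp1 hp2
    have hgp : (g.1 = p.1 ∧ (g.2 = p.2 ∨ g.2 = p.2 + 1 ∨ g.2 = p.2 - 1)) ∨
        (g.2 = p.2 ∧ (g.1 = p.1 + 1 ∨ g.1 = p.1 - 1)) := by
      rcases hg with rfl | ⟨-, hadj⟩
      · exact Or.inl ⟨rfl, Or.inl rfl⟩
      · simp only [planarAdj, Prod.ext_iff, Prod.fst_add, Prod.snd_add] at hadj; omega
    by_cases hzK : Side sx X z.1 ∧ Side sy Y z.2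
    · left; rw [memK]; exact ⟨⟨hz.1, hz.2.1, hzK.1⟩, ⟨hz.2.2.1, hz.2.2.2, hzK.2⟩⟩
    · right
      have key : (SideW (-sx) X z.1 ∧ SideW sy Y z.2) ∨ (SideW sx X z.1 ∧ SideW (-sy) Y z.2) := by
        clear hUV hUH hfree hKx hKy memK hKB hKM hKU hKUN hpK hent hcolM hc1 hc2 ha1 ha2
        unfold Side at hzK; unfold SideW
        rcases hsx with rfl | rfl <;> rcases hsy with rfl | rfl <;>
          rcases hgp with ⟨h1, h2⟩ | ⟨h1, h2⟩ <;> omega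
      rcases key with h1 | h1
      · exact hUV z hzB h1.1 h1.2
      · exact hUH z hzB h1.1 h1.2
  · rw [snapNbhd_union_eq_tileUnion] at ht ⊢
    exact exists_chain_col hF hCM hKU (by omega) hsx (c := c) (d := d) hcd hent
      (fun y hy1 hy2 => by rw [← snapNbhd_union_eq_tileUnion]; exact ⟨(hcolM y hy1 hy2).1, (hcolM y hy1 hy2).2.1⟩)
      ht htB f₁ f₂
  · rw [snapNbhd_eq_tileUnion] at ht ⊢
    refine exists_chain_col hF hCN hKUN (by omega) hsx (c := c) (d := d) hcd hent (fun y hy1 hy2 => ?_)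
      ht htB f₁ f₂
    obtain ⟨hM, hB', hsw⟩ := hcolM y hy1 hy2
    refine ⟨?_, hB'⟩
    by_cases hyY : y = Y
    · -- the hub `(X, Y)` lies in `N`, which meets the box at `t`
      have := (hub_mem_tileUnion hF (fun c hc => ⟨(hCN c hc).1, (hCN c hc).2.1⟩) ht htB).1
      rw [hub, max_eq_right (by omega : x₁ ≤ X), max_eq_right (by omega : y₁ ≤ Y)] at this
      rw [hyY]; exact this
    · rw [← snapNbhd_eq_tileUnion]
      by_contra hN
      rcases hM with hN' | hR
      · exact hN hN'
      · have hyK : (X + sx, y) ∈ K := by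
          rw [memK]; simp only
          rw [mem_boxR_iff] at hB'; simp only at hB'
          refine ⟨⟨by omega, by omega, by unfold Side; omega⟩, ⟨hB'.2.2.1, hB'.2.2.2, ?_⟩⟩
          unfold SideW at hsw; unfold Side; omega
        exact H _ hB' hR hN _ hyK (by simp only [planarAdj, Prod.ext_iff, Prod.fst_add, Prod.snd_add]; omega)
  · -- two target pairs
    obtain ⟨t, htB, htR, htN, b', hb', hadj⟩ := hT
    have hb'K := hb'
    rw [memK] at hb'
    have htnotK : ¬(Side sx X t.1 ∧ Side sy Y t.2) := fun hh => hfree t htB hh.1 hh.2 (Or.inr htR)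
    obtain ⟨b₂, t₂, hb₂, hne, ht₂, hadj₂⟩ := quad_second_pair hF hW ctx.hΓ hsx hsy hKx hKy hXr hYr htB htR htN
      hb'.1.2.2 hb'.2.2.2 htnotK hadj
    have hb₂K : b₂ ∈ K := by rw [hKdef]; exact hb₂
    exact ⟨b', t, b₂, t₂, hb'K, hb₂K, hne, ⟨htR, htN, htB⟩, ht₂, hadj, hadj₂⟩

/-! ## Layout `ell`: the tiles fill a closed quadrant of the box; route in the L around it -/

omit ctx in
/-- In the `ell` layout, once some cell of the quadrant is not in `N`, no cell of the box is in `N`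
(a tile of `N` meeting the box would fill the whole quadrant).
[cite: NewmanTassionWu2017, §3.5 (proof of Lemma 3.16)] -/
theorem ell_noN (hF : IsFrame n p x₁ x₂ y₁ y₂ X Y) (hW : IsFrameND n x₁ x₂ y₁ X Y)
    (hΓ : ∀ g ∈ Γ, 0 ≤ (planar k g).1 ∧ (planar k g).1 ≤ 7 * n ∧ 0 ≤ (planar k g).2)
    {sx sy : ℤ} (hXr : x₁ + 4 ≤ X ∧ X + 4 ≤ x₂) (hYr : y₁ + 4 ≤ Y ∧ Y + 4 ≤ y₂)
    (hU : ∀ z ∈ boxR x₁ x₂ y₁ y₂, z ∈ snapNbhd k n Γ ∪ snapNbhdR k n Γ ↔ (SideW sx X z.1 ∧ SideW sy Y z.2))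
    {t : ℤ × ℤ} (htB : t ∈ boxR x₁ x₂ y₁ y₂) (htR : t ∈ snapNbhdR k n Γ) (htN : t ∉ snapNbhd k n Γ) :
    ∀ w ∈ boxR x₁ x₂ y₁ y₂, w ∉ snapNbhd k n Γ := by
  intro w hwB hwN
  have hCN : ∀ c ∈ snapCentres k n Γ, LatCentre n c := fun c hc => latCentre_snapCentres hΓ hc
  have htQ := (hU t htB).1 (Or.inr htR)
  have htB' := htB; rw [mem_boxR_iff] at htB'
  rw [snapNbhd_eq_tileUnion] at hwN htN
  obtain ⟨lo, hi, lo', hi', hxT, hyT, hcov, hwin⟩ := tile_trace_int hF hW hCN hwN hwB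
  rw [mem_boxR_iff] at hwB
  have hc₁ : (lo, lo') ∈ boxR x₁ x₂ y₁ y₂ := by
    rw [mem_boxR_iff]; simp only; rcases hxT with h | h | h <;> rcases hyT with h' | h' | h' <;> omega
  have hc₂ : (hi, hi') ∈ boxR x₁ x₂ y₁ y₂ := by
    rw [mem_boxR_iff]; simp only; rcases hxT with h | h | h <;> rcases hyT with h' | h' | h' <;> omega
  have hc₁' := hc₁; have hc₂' := hc₂
  rw [mem_boxR_iff] at hc₁' hc₂'
  simp only at hc₁' hc₂'
  have h₁ := (hU _ hc₁).1 (Or.inl (by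
    rw [snapNbhd_eq_tileUnion]
    exact hcov _ le_rfl (by omega) le_rfl (by omega) hc₁'.1 hc₁'.2.1 hc₁'.2.2.1 hc₁'.2.2.2))
  have h₂ := (hU _ hc₂).1 (Or.inl (by
    rw [snapNbhd_eq_tileUnion]
    exact hcov _ (by omega) le_rfl (by omega) le_rfl hc₂'.1 hc₂'.2.1 hc₂'.2.2.1 hc₂'.2.2.2))
  simp only at h₁ h₂
  apply htN
  unfold SideW at htQ h₁ h₂
  refine hcov t ?_ ?_ ?_ ?_ htB'.1 htB'.2.1 htB'.2.2.1 htB'.2.2.2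
  · rcases hxT with h | h | h <;> omega
  · rcases hxT with h | h | h <;> omega
  · rcases hyT with h | h | h <;> omega
  · rcases hyT with h | h | h <;> omega

/-- **Layout `ell sx sy`**: `M ∩ B₀` is the closed quadrant at `(X, Y)`; `K` is the L-shaped cross
around it, port column `x = X` inside the quadrant.
[cite: NewmanTassionWu2017, §3.5 (proof of Lemma 3.16, "K_□ … regular enough")] -/
theorem gadget_ell {sx sy a b c d : ℤ} (hsx : sx = 1 ∨ sx = -1) (hsy : sy = 1 ∨ sy = -1)
    (hKx : ∀ x : ℤ, (a ≤ x ∧ x ≤ b) ↔ (x₁ ≤ x ∧ x ≤ x₂ ∧ Side (-sx) X x))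
    (hKy : ∀ y : ℤ, (c ≤ y ∧ y ≤ d) ↔ (y₁ ≤ y ∧ y ≤ y₂ ∧ Side (-sy) Y y))
    (hab : a + 2 ≤ b) (hcd : c + 3 ≤ d) (hXr : x₁ + 4 ≤ X ∧ X + 4 ≤ x₂) (hYr : y₁ + 4 ≤ Y ∧ Y + 4 ≤ y₂)
    (hU : ∀ z ∈ boxR x₁ x₂ y₁ y₂, z ∈ snapNbhd k n Γ ∪ snapNbhdR k n Γ ↔ (SideW sx X z.1 ∧ SideW sy Y z.2))
    (hp : Side (-sx) X p.1 ∨ Side (-sy) Y p.2) :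
    ∃ ω', GadgetSpec (snapGlue k n hn Γ) k 14 ω ω' := by
  have hF := ctx.hF; have hW := ctx.hW; have hk := ctx.hk
  have hpx₁ := hF.hpx₁; have hpx₂ := hF.hpx₂; have hpy₁ := hF.hpy₁; have hpy₂ := hF.hpy₂
  have hCM := ctx.latCentre_M
  have hCN := ctx.latCentre_N
  obtain ⟨ha1, ha2⟩ : (x₁ ≤ a ∧ a ≤ x₂ ∧ Side (-sx) X a) ∧ (x₁ ≤ b ∧ b ≤ x₂ ∧ Side (-sx) X b) :=
    ⟨(hKx a).1 ⟨le_rfl, by omega⟩, (hKx b).1 ⟨by omega, le_rfl⟩⟩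
  obtain ⟨hc1, hc2⟩ : (y₁ ≤ c ∧ c ≤ y₂ ∧ Side (-sy) Y c) ∧ (y₁ ≤ d ∧ d ≤ y₂ ∧ Side (-sy) Y d) :=
    ⟨(hKy c).1 ⟨le_rfl, by omega⟩, (hKy d).1 ⟨by omega, le_rfl⟩⟩
  set K : Set (ℤ × ℤ) := boxR a b y₁ y₂ ∪ boxR x₁ x₂ c d with hKdef
  have memK : ∀ z : ℤ × ℤ, z ∈ K ↔ (x₁ ≤ z.1 ∧ z.1 ≤ x₂ ∧ y₁ ≤ z.2 ∧ z.2 ≤ y₂) ∧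
      (Side (-sx) X z.1 ∨ Side (-sy) Y z.2) := by
    intro z
    rw [hKdef, Set.mem_union, mem_boxR_iff, mem_boxR_iff]
    constructor
    · rintro (⟨h1, h2, h3, h4⟩ | ⟨h1, h2, h3, h4⟩)
      · have := (hKx z.1).1 ⟨h1, h2⟩; exact ⟨⟨this.1, this.2.1, h3, h4⟩, Or.inl this.2.2⟩
      · have := (hKy z.2).1 ⟨h3, h4⟩; exact ⟨⟨h1, h2, this.1, this.2.1⟩, Or.inr this.2.2⟩
    · rintro ⟨⟨h1, h2, h3, h4⟩, h | h⟩
      · exact Or.inl ⟨((hKx z.1).2 ⟨h1, h2, h⟩).1, ((hKx z.1).2 ⟨h1, h2, h⟩).2, h3, h4⟩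
      · exact Or.inr ⟨h1, h2, ((hKy z.2).2 ⟨h3, h4, h⟩).1, ((hKy z.2).2 ⟨h3, h4, h⟩).2⟩
  have hKB : K ⊆ boxR x₁ x₂ y₁ y₂ := fun z hz => by rw [memK] at hz; rw [mem_boxR_iff]; exact hz.1
  have hKM : ∀ z ∈ K, z ∉ snapNbhd k n Γ ∧ z ∉ snapNbhdR k n Γ := by
    intro z hz
    have hzB := hKB hz
    rw [memK] at hz
    have : z ∉ snapNbhd k n Γ ∪ snapNbhdR k n Γ := fun h' => by
      have := (hU z hzB).1 h'; unfold Side SideW at *; omega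
    exact ⟨fun h' => this (Or.inl h'), fun h' => this (Or.inr h')⟩
  have hKU : ∀ z ∈ K, z ∉ tileUnion (snapCentres k n Γ ∪ snapCentresR k n Γ) := by
    intro z hz; rw [← snapNbhd_union_eq_tileUnion]; exact fun h' => (hKM z hz).elim fun h1 h2 => h'.elim h1 h2
  have hKUN : ∀ z ∈ K, z ∉ tileUnion (snapCentres k n Γ) := by
    intro z hz; rw [← snapNbhd_eq_tileUnion]; exact (hKM z hz).1
  have hpK : p ∈ K := by rw [memK]; exact ⟨⟨hpx₁, hpx₂, hpy₁, hpy₂⟩, hp⟩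
  -- entry cells on the vertical bar next to the port column, and the port column inside the quadrant
  have hent : ∀ y : ℤ, y₁ ≤ y → y ≤ y₂ → (X + -sx, y) ∈ K := by
    intro y h1 h2; rw [memK]; simp only; unfold Side; refine ⟨⟨by omega, by omega, h1, h2⟩, Or.inl (by omega)⟩
  have hcolM : ∀ y : ℤ, y₁ ≤ y → y ≤ y₂ → SideW sy Y y →
      (X, y) ∈ snapNbhd k n Γ ∪ snapNbhdR k n Γ ∧ (X, y) ∈ boxR x₁ x₂ y₁ y₂ := by
    intro y h1 h2 h3
    have hzB : (X, y) ∈ boxR x₁ x₂ y₁ y₂ := by rw [mem_boxR_iff]; simp only; omega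
    exact ⟨(hU _ hzB).2 ⟨by unfold SideW; simp only; omega, h3⟩, hzB⟩
  -- the port rows: the quadrant's rows
  obtain ⟨c', d', hc'd', hrange⟩ : ∃ c' d' : ℤ, c' + 3 ≤ d' ∧ ∀ y : ℤ,
      (min c' (max y₁ Y) ≤ y ∧ y ≤ max d' (max y₁ Y)) → (y₁ ≤ y ∧ y ≤ y₂ ∧ SideW sy Y y) := by
    rcases hsy with rfl | rfl
    · refine ⟨Y, y₂, by omega, fun y hy => ?_⟩
      unfold SideW; omega
    · refine ⟨y₁, Y, by omega, fun y hy => ?_⟩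
      unfold SideW; omega
  have hs' : -sx = 1 ∨ -sx = -1 := by omega
  refine ctx.gadget hKB hKM hpK (fun E₁ E₂ w hE₁ hE₂ hw hne h1 h2 => ?_) (fun g _ z hz _ => ?_)
    (fun t ht htB htK f₁ f₂ => ?_) (fun H t ht htB htK f₁ f₂ => ?_) (fun hT => ?_)
  · exact exists_route_cross hk hab hcd hc1.1 hc2.2.1 ha1.1 ha2.2.1 hE₁ hE₂ hw hne h1 h2
  · by_cases hq : SideW sx X z.1 ∧ SideW sy Y z.2
    · exact Or.inr ((hU z hz).2 hq)
    · left; rw [memK]; rw [mem_boxR_iff] at hz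
      refine ⟨hz, ?_⟩; unfold Side; unfold SideW at hq; omega
  · rw [snapNbhd_union_eq_tileUnion] at ht ⊢
    exact exists_chain_col hF hCM hKU (by omega) hs' hc'd' (fun y h1 h2 => hent y (hrange y ⟨by
        rw [min_def]; split_ifs <;> omega, by rw [max_def]; split_ifs <;> omega⟩).1
        (hrange y ⟨by rw [min_def]; split_ifs <;> omega, by rw [max_def]; split_ifs <;> omega⟩).2.1)
      (fun y hy1 hy2 => by
        rw [← snapNbhd_union_eq_tileUnion]
        obtain ⟨h1, h2, h3⟩ := hrange y ⟨hy1, hy2⟩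
        exact hcolM y h1 h2 h3)
      ht htB f₁ f₂
  · rw [snapNbhd_eq_tileUnion] at ht ⊢
    refine exists_chain_col hF hCN hKUN (by omega) hs' hc'd' (fun y h1 h2 => hent y (hrange y ⟨by
        rw [min_def]; split_ifs <;> omega, by rw [max_def]; split_ifs <;> omega⟩).1
        (hrange y ⟨by rw [min_def]; split_ifs <;> omega, by rw [max_def]; split_ifs <;> omega⟩).2.1)
      (fun y hy1 hy2 => ?_) ht htB f₁ f₂
    obtain ⟨h1, h2, h3⟩ := hrange y ⟨hy1, hy2⟩
    obtain ⟨hM, hB'⟩ := hcolM y h1 h2 h3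
    refine ⟨?_, hB'⟩
    rw [← snapNbhd_eq_tileUnion]
    by_contra hN
    rcases hM with hN' | hR
    · exact hN hN'
    · exact H _ hB' hR hN _ (hent y h1 h2) (by simp only [planarAdj, Prod.ext_iff, Prod.fst_add, Prod.snd_add]; omega)
  · -- two target pairs through the corner `(X, Y)`
    obtain ⟨t, htB, htR, htN, -, -, -⟩ := hT
    have hnoN := ell_noN hF hW ctx.hΓ hXr hYr hU htB htR htN
    have hcB : (X, Y) ∈ boxR x₁ x₂ y₁ y₂ := by rw [mem_boxR_iff]; simp only; omega
    have hcM : (X, Y) ∈ snapNbhd k n Γ ∪ snapNbhdR k n Γ := (hU _ hcB).2 (by unfold SideW; simp only; omega)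
    have hcN : (X, Y) ∉ snapNbhd k n Γ := hnoN _ hcB
    have hcR : (X, Y) ∈ snapNbhdR k n Γ := hcM.resolve_left hcN
    have hb₁ : (X + -sx, Y) ∈ K := hent Y (by omega) (by omega)
    have hb₂ : (X, Y + -sy) ∈ K := by
      rw [memK]; simp only; unfold Side; exact ⟨⟨by omega, by omega, by omega, by omega⟩, Or.inr (by omega)⟩
    refine ⟨(X + -sx, Y), (X, Y), (X, Y + -sy), (X, Y), hb₁, hb₂, ?_, ⟨hcR, hcN, hcB⟩, ⟨hcR, hcN, hcB⟩, ?_, ?_⟩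
    · intro h; have := congrArg Prod.fst h; simp only at this; omega
    · simp only [planarAdj, Prod.ext_iff, Prod.fst_add, Prod.snd_add]; omega
    · simp only [planarAdj, Prod.ext_iff, Prod.fst_add, Prod.snd_add]; omega

/-! ## All layouts -/

/-- **The local modification in any layout of the frame.**
[cite: NewmanTassionWu2017, §3.5 (proof of Lemma 3.16, "the domain K_□ is regular enough to apply Theorem 3.6")] -/
theorem gadget_of_layout (lay : Layout x₁ x₂ y₁ y₂ X Y (snapNbhd k n Γ ∪ snapNbhdR k n Γ) p) :
    ∃ ω', GadgetSpec (snapGlue k n hn Γ) k 14 ω ω' := by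
  rcases lay with h | ⟨s, a, b, hs, hK, hab, hXr, hp, hU⟩ | ⟨s, c, d, hs, hK, hcd, hYr, hp, hU⟩ |
    ⟨sx, sy, a, b, c, d, hsx, hsy, hKx, hKy, hab, hcd, hXr, hYr, hp, hfree, hUV, hUH⟩ |
    ⟨sx, sy, a, b, c, d, hsx, hsy, hKx, hKy, hab, hcd, hXr, hYr, hU, hp⟩
  · exact ctx.gadget_clear h
  · exact ctx.gadget_halfV hs hK hab hXr hp hU
  · exact ctx.gadget_halfH hs hK hcd hYr hp hU
  · exact ctx.gadget_quad hsx hsy hKx hKy hab hcd hXr hYr hp hfree hUV hUH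
  · exact ctx.gadget_ell hsx hsy hKx hKy hab hcd hXr hYr hU hp

end LocalCtx

end NTW17

end Literature.Probability.Percolation
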